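import Literature.MathematicalPhysics.QuantumLattice.SectorSpectrum
import Literature.MathematicalPhysics.QuantumLattice.SectorEigenvalueContinuation
import HarnessLib

/-!
# Variational bookkeeping in a coordinate sector: Rayleigh scaling, compactness, blocks

Family `hubbard` (trunk T-QLATTICE). Elementary finite-dimensional lemmas, stated for an arbitrary
finite index type `ι`, vectors `ι → ℂ` and a COORDINATE SECTOR `{v | v i = 0 unless p i}` (the
conventions of the `QuantumLattice` files: `⟨v, w⟩ = star v ⬝ᵥ w`, energies `Re ⟨v, A v⟩`). They
complement `SectorSpectrum` (`sector_groundState`) and `SectorEigenvalueContinuation`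
(`mulVec_eq_smul_of_forall_le_on`, `continuous_energy`, `isCompact_unitSphere_inter`, …), which are
reused, and are the abstract layer of singular-perturbation ("`g → 0⁺`") descents of block ground
states (used by route ColourTheSpin of `HubbardSuperconductivity`, crux `SgEndpoint`):

* `rayleigh_of_unit` — a Rayleigh lower bound on the UNIT vectors of the sector is the bound
  `e · ‖v‖² ≤ Re ⟨v, A v⟩` on all vectors of the sector (scaling);
* `isCompact_unitSector` — the unit vectors of a coordinate sector form a compact set;
* `toBlock_mulVec_restrict`, `star_restrict_dotProduct_toBlock_mulVec`, `restrict_extend`,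
  `extend_restrict` — bookkeeping between a principal block `M.toBlock p p` and `M` on vectors
  supported in `p` (restriction / extension by zero);
* `le_of_tendsto_of_le` / `ge_of_tendsto_of_ge` — passing `F (Ψ n) ≤ u n`, `u n → c` to a
  subsequential limit point of `Ψ`.

No definitions. Reed–Simon IV, Theorems XIII.1–2; H. Tasaki, *Physics and Mathematics of Quantum
Many-Body Systems* (2020) §2.1 (variational characterisation of the ground-state energy). All
statements are folklore.

## Mathlib search

`Matrix.toBlock`, `Metric.isCompact_of_isClosed_isBounded`, `pi_norm_le_iff_of_nonneg`,
`le_of_tendsto_of_tendsto'`, `StrictMono.tendsto_atTop`; no sector/Rayleigh statements of this kind.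
-/

noncomputable section

namespace Literature.MathematicalPhysics.QuantumLattice

open Matrix Filter _root_.Topology
open scoped ComplexOrder

section Spectral

variable {ι : Type*} [Fintype ι]

/-- For a Hermitian matrix the quadratic form is real: `Im ⟨w, Y w⟩ = 0`. [folklore] -/
theorem im_quadForm_eq_zero {Y : Matrix ι ι ℂ} (hY : Y.IsHermitian) (w : ι → ℂ) :
    (star w ⬝ᵥ Y *ᵥ w).im = 0 := by
  have h : star (star w ⬝ᵥ Y *ᵥ w) = star w ⬝ᵥ Y *ᵥ w := by
    calc star (star w ⬝ᵥ Y *ᵥ w) = star (Y *ᵥ w) ⬝ᵥ w := by rw [star_dotProduct, star_star]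
      _ = star w ⬝ᵥ Yᴴ *ᵥ w := by rw [star_mulVec, ← dotProduct_mulVec]
      _ = star w ⬝ᵥ Y *ᵥ w := by rw [hY.eq]
  rw [Complex.star_def] at h
  exact Complex.conj_eq_iff_im.1 h

/-- Scaling of quadratic forms: `⟨c v, M (c v)⟩ = |c|² ⟨v, M v⟩`. [folklore] -/
theorem quadForm_smul (M : Matrix ι ι ℂ) (c : ℂ) (v : ι → ℂ) :
    star (c • v) ⬝ᵥ M *ᵥ (c • v) = (star c * c) * (star v ⬝ᵥ M *ᵥ v) := by
  rw [star_smul, mulVec_smul, smul_dotProduct, dotProduct_smul, smul_smul, smul_eq_mul]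

/-- **Scaling a Rayleigh bound.** If `e ≤ Re ⟨v, A v⟩` for every UNIT vector of the coordinate sector
`p`, then `e · Re ⟨v, v⟩ ≤ Re ⟨v, A v⟩` for every vector of the sector. [folklore] -/
theorem rayleigh_of_unit {A : Matrix ι ι ℂ} {p : ι → Prop} {e : ℝ}
    (h : ∀ v : ι → ℂ, (∀ i, ¬ p i → v i = 0) → star v ⬝ᵥ v = 1 → e ≤ (star v ⬝ᵥ A *ᵥ v).re)
    (v : ι → ℂ) (hv : ∀ i, ¬ p i → v i = 0) :
    e * (star v ⬝ᵥ v).re ≤ (star v ⬝ᵥ A *ᵥ v).re := by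
  by_cases hv0 : v = 0
  · subst hv0
    simp
  obtain ⟨c, hc, hunit⟩ := exists_smul_unit hv0
  have hsupp : ∀ i, ¬ p i → (c • v) i = 0 := fun i hi => by simp [hv i hi]
  have hle := h (c • v) hsupp hunit
  have hcc : star (c • v) ⬝ᵥ (c • v) = (star c * c) * (star v ⬝ᵥ v) := by
    rw [star_smul, smul_dotProduct, dotProduct_smul, smul_smul, smul_eq_mul]
  rw [quadForm_smul] at hle
  rw [hcc] at hunit
  have hreal : star c * c = ((Complex.normSq c : ℝ) : ℂ) := by
    rw [Complex.star_def, Complex.normSq_eq_conj_mul_self]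
  rw [hreal] at hle hunit
  have hn : 0 < Complex.normSq c := Complex.normSq_pos.2 hc
  have hunit' : Complex.normSq c * (star v ⬝ᵥ v).re = 1 := by
    have := congrArg Complex.re hunit
    simpa [Complex.mul_re, EigenvalueContinuation.im_star_dotProduct_self] using this
  have hle' : e ≤ Complex.normSq c * (star v ⬝ᵥ A *ᵥ v).re := by
    have : ((((Complex.normSq c : ℝ) : ℂ)) * (star v ⬝ᵥ A *ᵥ v)).re =
        Complex.normSq c * (star v ⬝ᵥ A *ᵥ v).re := by
      simp [Complex.mul_re]
    rw [this] at hle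
    exact hle
  have hvv : (star v ⬝ᵥ v).re = (Complex.normSq c)⁻¹ := by
    field_simp at hunit' ⊢
    linarith
  rw [hvv]
  have := mul_le_mul_of_nonneg_left hle' (inv_nonneg.2 hn.le)
  rw [← mul_assoc, inv_mul_cancel₀ hn.ne', one_mul] at this
  linarith [this]

/-- **The unit vectors of a coordinate sector form a compact set** (closed and bounded in the
finite-dimensional space `ι → ℂ`). [folklore] -/
theorem isCompact_unitSector (p : ι → Prop) :
    IsCompact {v : ι → ℂ | (∀ i, ¬ p i → v i = 0) ∧ star v ⬝ᵥ v = 1} := by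
  apply Metric.isCompact_of_isClosed_isBounded
  · have h1 : IsClosed {v : ι → ℂ | ∀ i, ¬ p i → v i = 0} := by
      rw [Set.setOf_forall]
      refine isClosed_iInter fun i => ?_
      by_cases hi : p i
      · simp [hi]
      · simp only [hi, not_false_eq_true, forall_const]
        exact isClosed_eq (continuous_apply i) continuous_const
    have h2 : IsClosed {v : ι → ℂ | star v ⬝ᵥ v = 1} :=
      isClosed_eq (continuous_star.dotProduct continuous_id) continuous_const
    rw [Set.setOf_and]
    exact h1.inter h2
  · refine (Metric.isBounded_iff_subset_closedBall (0 : ι → ℂ)).2 ⟨1, fun v hv => ?_⟩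
    rw [Metric.mem_closedBall, dist_zero_right, pi_norm_le_iff_of_nonneg zero_le_one]
    intro i
    have h1 : (star v ⬝ᵥ v).re = 1 := by rw [hv.2]; simp
    have hi := EigenvalueContinuation.norm_apply_sq_le v i
    rw [h1] at hi
    nlinarith [norm_nonneg (v i)]

/-- **Passing an inequality to a limit point.** If `F` is continuous, `F (Ψ n) ≤ u n` for all `n`,
`u n → c` and `Ψ (φ n) → a` along a subsequence, then `F a ≤ c`. [folklore] -/
theorem le_of_tendsto_of_le {X : Type*} [TopologicalSpace X] {F : X → ℝ} (hF : Continuous F)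
    {Ψ : ℕ → X} {u : ℕ → ℝ} {c : ℝ} (hle : ∀ n, F (Ψ n) ≤ u n) (hu : Tendsto u atTop (𝓝 c))
    {φ : ℕ → ℕ} (hφ : StrictMono φ) {a : X} (ha : Tendsto (Ψ ∘ φ) atTop (𝓝 a)) : F a ≤ c := by
  have h1 : Tendsto (fun n => F (Ψ (φ n))) atTop (𝓝 (F a)) := (hF.tendsto a).comp ha
  have h2 : Tendsto (fun n => u (φ n)) atTop (𝓝 c) := hu.comp hφ.tendsto_atTop
  exact le_of_tendsto_of_tendsto' h1 h2 fun n => hle (φ n)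

/-- The symmetric version: `c ≤ F a` from `u n ≤ F (Ψ n)`. [folklore] -/
theorem ge_of_tendsto_of_ge {X : Type*} [TopologicalSpace X] {F : X → ℝ} (hF : Continuous F)
    {Ψ : ℕ → X} {u : ℕ → ℝ} {c : ℝ} (hle : ∀ n, u n ≤ F (Ψ n)) (hu : Tendsto u atTop (𝓝 c))
    {φ : ℕ → ℕ} (hφ : StrictMono φ) {a : X} (ha : Tendsto (Ψ ∘ φ) atTop (𝓝 a)) : c ≤ F a := by
  have h1 : Tendsto (fun n => F (Ψ (φ n))) atTop (𝓝 (F a)) := (hF.tendsto a).comp ha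
  have h2 : Tendsto (fun n => u (φ n)) atTop (𝓝 c) := hu.comp hφ.tendsto_atTop
  exact le_of_tendsto_of_tendsto' h2 h1 fun n => hle (φ n)

end Spectral

/-! ### A block `M.toBlock p p` versus `M` on vectors supported in `p` -/

section Block

variable {α : Type*} [Fintype α] (p : α → Prop) [DecidablePred p]

/-- Restricting a vector supported in `p` to the block and multiplying by `M.toBlock p p` is
restricting `M v`. [folklore] -/
theorem toBlock_mulVec_restrict (M : Matrix α α ℂ) (v : α → ℂ) (hv : ∀ a, ¬ p a → v a = 0) :
    M.toBlock p p *ᵥ (fun a : {a // p a} => v a.1) = fun a : {a // p a} => (M *ᵥ v) a.1 := by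
  funext a
  rw [mulVec, dotProduct, mulVec, dotProduct, sum_eq_sum_subtype_of_support p]
  · rfl
  · intro b hb
    rw [hv b hb, mul_zero]

/-- The pairing of restrictions of vectors, the first supported in `p`, is their pairing.
[folklore] -/
theorem star_restrict_dotProduct_restrict (v w : α → ℂ) (hv : ∀ a, ¬ p a → v a = 0) :
    star (fun a : {a // p a} => v a.1) ⬝ᵥ (fun a : {a // p a} => w a.1) = star v ⬝ᵥ w := by
  rw [dotProduct, dotProduct, sum_eq_sum_subtype_of_support p]
  · rfl
  · intro b hb
    rw [Pi.star_apply, hv b hb, star_zero, zero_mul]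

/-- The block quadratic form of the restriction of a vector supported in `p` is the quadratic form
of `M`. [folklore] -/
theorem star_restrict_dotProduct_toBlock_mulVec (M : Matrix α α ℂ) (v : α → ℂ)
    (hv : ∀ a, ¬ p a → v a = 0) :
    star (fun a : {a // p a} => v a.1) ⬝ᵥ M.toBlock p p *ᵥ (fun a : {a // p a} => v a.1) =
      star v ⬝ᵥ M *ᵥ v := by
  rw [toBlock_mulVec_restrict p M v hv, star_restrict_dotProduct_restrict p v (M *ᵥ v) hv]

omit [Fintype α] in
/-- The extension by zero of a block vector is supported in `p`. [folklore] -/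
theorem extend_apply_of_not (ψ : {a // p a} → ℂ) (a : α) (ha : ¬ p a) :
    (fun b : α => if h : p b then ψ ⟨b, h⟩ else 0) a = 0 := by
  simp [ha]

omit [Fintype α] in
/-- Restricting the extension by zero gives back the block vector. [folklore] -/
theorem restrict_extend (ψ : {a // p a} → ℂ) :
    (fun a : {a // p a} => (fun b : α => if h : p b then ψ ⟨b, h⟩ else 0) a.1) = ψ := by
  funext a
  simp [a.2]

omit [Fintype α] in
/-- Extending the restriction of a vector supported in `p` gives it back. [folklore] -/
theorem extend_restrict (v : α → ℂ) (hv : ∀ a, ¬ p a → v a = 0) :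
    (fun b : α => if h : p b then (fun a : {a // p a} => v a.1) ⟨b, h⟩ else 0) = v := by
  funext b
  by_cases hb : p b
  · simp [hb]
  · simp [hb, hv b hb]

end Block

end Literature.MathematicalPhysics.QuantumLattice

end
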